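import Mathlib
import Summits.Ventures.HodgeRepro.Tier3LocalLiftNonvanishing

/-!
# Tier3LocalFactorReduction — (b5)'s reduction «θ(F̄_τ, ϕ) ≠ 0 ⟺ every local factor ≠ 0» and the datum form
of its finite-place sentence (T3.5 for T3.1; PERIOD.md §4.3 (b5))

PERIOD.md §4.3 (b5): «`u_τ ≠ 0 ⟺ F_τ ≠ 0 ∧ θ(F̄_τ, ϕ) ≠ 0`, and by (b3) with `f₁ = f₂ = F_τ` the latter ⟺ every
local factor `Z♯_v(½, F_{τ,v}, F_{τ,v}, Φ_v) ≠ 0` (the local factors are the local theta pairings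
`‖θ_v(F_{τ,v}, ϕ_v)‖² ≥ 0`)».  (b3) is the Rallis inner product (Harris Thm 5.15, PRINTED):
`⟨θ(f̄₁,ϕ₁), θ(f̄₂,ϕ₂)⟩ = L · ∏_v Z♯_v`, with the edge `L`-value `L ≠ 0` and `Z♯_v = 1` for almost all `v`.
This file is the elementary content of that sentence and of the «`ϕ′_v`-freedom» clause that follows it:
* `mul_prod_ne_zero_iff` / `mul_prod_ne_zero_iff_forall`: `L · ∏_{v ∈ s} Z v ≠ 0 ⟺ ∀ v, Z v ≠ 0` for `L ≠ 0`
  and `Z v = 1` off the finite set `s` (the Euler product of Thm 5.15 is a finite product of the ramified factors);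
* `lift_ne_zero_iff_forall_local` / **`lift_ne_zero_iff_forall_local_lift`**: with `⟪θ, θ⟫ = L · ∏_{v ∈ s} ⟪θ_v, θ_v⟫`
  (the Rallis inner product for `f₁ = f₂`, the local factors being the local theta pairings), `θ ≠ 0 ⟺ ∀ v ∈ s, θ_v ≠ 0`
  — Mathlib's `inner_self_ne_zero` at every place;
* **`exists_datum_pairing_ne_zero`** / `exists_exists_datum_pairing_ne_zero`: the DATUM form of (b5)'s finite-place
  pairing sentence («the same `ϕ′_v`-freedom makes `⟨θ_v(F_{τ,v},ϕ_v), θ_v(F′_{τ,v},ϕ′_v)⟩ ≠ 0`»): when the lift is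
  linear in the datum (`Θ F : S →ₗ[k] π`), its values span an `R`-stable non-zero subspace of the simple `π` and the
  pairing is non-degenerate, every non-zero `y` (in particular `y = Θ F′ ϕ′`) pairs non-trivially with some
  `Θ F ϕ₀` — the translate `r • Θ F ϕ` of Tier3LocalLiftNonvanishing's `exists_exists_smul_pairing_ne_zero` is here
  a datum, as the sentence says (T3-P1-NOTE-g12-TWINS §3, nuance N7).
What stays on the page: the Rallis inner product itself and its normalisation (PRINTED), the non-vanishing of the
edge `L`-value (cite-only, ADDENDUM-9 §A9.9), the identification of `Z♯_v` with the local theta pairing (cite-only,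
(b5)), the linearity of the local lift in the datum and its `U(V_v)`-equivariance.  No definition, no notation;
imports Mathlib and Tier3LocalLiftNonvanishing.
Nothing here asserts anything about the original programme; HC_CM is NOT proved by anyone in this repository.
-/

namespace HodgeRepro.T3P1.LocalFactorReduction

section Product

variable {ι : Type*}

/-- A finite product with a non-zero constant factor is non-zero iff every factor is. -/
theorem mul_prod_ne_zero_iff (s : Finset ι) {L : ℂ} (hL : L ≠ 0) (Z : ι → ℂ) :
    L * ∏ v ∈ s, Z v ≠ 0 ↔ ∀ v ∈ s, Z v ≠ 0 := by
  rw [mul_ne_zero_iff, Finset.prod_ne_zero_iff]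
  exact ⟨fun h => h.2, fun h => ⟨hL, h⟩⟩

/-- The Euler-product form: if the factors are `1` off the finite set `s` (the unramified places), the product
is non-zero iff EVERY factor is non-zero. -/
theorem mul_prod_ne_zero_iff_forall (s : Finset ι) {L : ℂ} (hL : L ≠ 0) (Z : ι → ℂ)
    (hZ : ∀ v ∉ s, Z v = 1) : L * ∏ v ∈ s, Z v ≠ 0 ↔ ∀ v, Z v ≠ 0 := by
  rw [mul_prod_ne_zero_iff s hL Z]
  constructor
  · intro h v
    by_cases hv : v ∈ s
    · exact h v hv
    · rw [hZ v hv]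
      exact one_ne_zero
  · intro h v _
    exact h v

end Product

section LocalPairing

open scoped InnerProductSpace

variable {ι : Type*} {P : Type*} [NormedAddCommGroup P] [InnerProductSpace ℂ P]

/-- **(b5), the reduction to the local factors.** If `⟪θ, θ⟫ = L · ∏_{v ∈ s} Z v` with `L ≠ 0` (the Rallis inner
product for `f₁ = f₂ = F_τ`), then `θ ≠ 0 ⟺ ∀ v ∈ s, Z v ≠ 0`. -/
theorem lift_ne_zero_iff_forall_local (s : Finset ι) (θ : P) {L : ℂ} (hL : L ≠ 0) (Z : ι → ℂ)
    (hRIP : ⟪θ, θ⟫_ℂ = L * ∏ v ∈ s, Z v) : θ ≠ 0 ↔ ∀ v ∈ s, Z v ≠ 0 := by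
  rw [← inner_self_ne_zero (𝕜 := ℂ), hRIP, mul_prod_ne_zero_iff s hL Z]

/-- The same with the local factors written as the local theta pairings `⟪θ_v, θ_v⟫`: the global lift is
non-zero iff every local lift `θ_v` is. -/
theorem lift_ne_zero_iff_forall_local_lift (s : Finset ι) (θ : P) {L : ℂ} (hL : L ≠ 0)
    {Pv : ι → Type*} [∀ v, NormedAddCommGroup (Pv v)] [∀ v, InnerProductSpace ℂ (Pv v)]
    (θv : ∀ v, Pv v) (hRIP : ⟪θ, θ⟫_ℂ = L * ∏ v ∈ s, ⟪θv v, θv v⟫_ℂ) :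
    θ ≠ 0 ↔ ∀ v ∈ s, θv v ≠ 0 := by
  rw [lift_ne_zero_iff_forall_local s θ hL _ hRIP]
  exact forall₂_congr fun v _ => inner_self_ne_zero (𝕜 := ℂ)

end LocalPairing

section Datum

variable {k : Type*} [Field k] {R : Type*} [Ring R]
variable {π : Type*} [AddCommGroup π] [Module k π] [Module R π]
variable {S : Type*} [AddCommGroup S] [Module k S]

/-- **The datum form of (b5)'s finite-place pairing sentence.** Let the local lift of `F` be linear in the datum,
`ΘF : S →ₗ[k] π`, with values spanning an `R`-stable (the `U(V_v)`-equivariance in `ϕ`) non-zero subspace of the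
simple `π`, and let `B` be non-degenerate («every `y ≠ 0` pairs non-trivially with some `x`»). Then every `y ≠ 0`
pairs non-trivially with the lift of SOME datum: `∃ ϕ₀, B (ΘF ϕ₀) y ≠ 0`. -/
theorem exists_datum_pairing_ne_zero [IsSimpleModule R π] {κ : Type*} [Zero κ] (ΘF : S →ₗ[k] π)
    (hstable : ∀ r : R, ∀ x ∈ Submodule.span k (Set.range ΘF),
      r • x ∈ Submodule.span k (Set.range ΘF))
    (hne : ∃ ϕ, ΘF ϕ ≠ 0) (B : π → π → κ) (hBnd : ∀ y : π, y ≠ 0 → ∃ x : π, B x y ≠ 0)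
    {y : π} (hy : y ≠ 0) : ∃ ϕ₀ : S, B (ΘF ϕ₀) y ≠ 0 := by
  obtain ⟨x, hx⟩ := hBnd y hy
  have htop : Submodule.span k (Set.range ΘF) = ⊤ :=
    HodgeRepro.T3P1.LocalLift.span_range_eq_top (R := R) (⇑ΘF) hstable hne
  have hxmem : x ∈ Submodule.span k (Set.range ΘF) := by
    rw [htop]
    exact Submodule.mem_top
  have hle : Submodule.span k (Set.range ΘF) ≤ LinearMap.range ΘF :=
    Submodule.span_le.mpr fun _ ⟨ϕ, hϕ⟩ => LinearMap.mem_range.mpr ⟨ϕ, hϕ⟩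
  obtain ⟨ϕ₀, hϕ₀⟩ := LinearMap.mem_range.mp (hle hxmem)
  exact ⟨ϕ₀, by rw [hϕ₀]; exact hx⟩

/-- «The same `ϕ′_v`-freedom makes the pairing non-zero once both lifts are»: for two lifts `ΘF`, `ΘF′` linear in
the datum, the first as above and the second non-zero somewhere, there are data `ϕ₀, ϕ′` with
`B (ΘF ϕ₀) (ΘF′ ϕ′) ≠ 0`. -/
theorem exists_exists_datum_pairing_ne_zero [IsSimpleModule R π] {κ : Type*} [Zero κ]
    (ΘF ΘF' : S →ₗ[k] π)
    (hstable : ∀ r : R, ∀ x ∈ Submodule.span k (Set.range ΘF),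
      r • x ∈ Submodule.span k (Set.range ΘF))
    (hne : ∃ ϕ, ΘF ϕ ≠ 0) (hne' : ∃ ϕ', ΘF' ϕ' ≠ 0) (B : π → π → κ)
    (hBnd : ∀ y : π, y ≠ 0 → ∃ x : π, B x y ≠ 0) :
    ∃ ϕ₀ ϕ' : S, B (ΘF ϕ₀) (ΘF' ϕ') ≠ 0 := by
  obtain ⟨ϕ', hϕ'⟩ := hne'
  obtain ⟨ϕ₀, hϕ₀⟩ := exists_datum_pairing_ne_zero (R := R) ΘF hstable hne B hBnd hϕ'
  exact ⟨ϕ₀, ϕ', hϕ₀⟩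

end Datum

end HodgeRepro.T3P1.LocalFactorReduction
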